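import Literature.Geometry.Riemannian.MetricFlowFLimitWithinAux
import Literature.Geometry.Riemannian.MetricFlowFLimitAdmissible
import HarnessLib

/-!
# Existence of the limit within a correspondence (Bamler 2023, §5.4, Lemma 5.20), from the
# construction of the limit pair

R. Bamler, *Compactness theory of the space of super Ricci flows*, Invent. Math. 233 (2023), §5.4,
Lemma 5.20 (arXiv v1 Lemma 121): *"Let `(𝒳ⁱ, (μⁱ_t)_{t ∈ I'^{,i}})`, `i ∈ ℕ`, be a sequence of
metric flows over `I` that are fully defined over `J`. Consider a correspondence
`ℭ := ((Z_t, d^Z_t)_{t ∈ I}, (φⁱ_t)_{t ∈ I''^{,i}, i ∈ ℕ})` between the metric flows `𝒳ⁱ` over `I`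
that is also fully defined over `J` and suppose that the metric spaces `(Z_t, d^Z_t)_{t ∈ I}` are
complete. Suppose that the metric flow pairs `(𝒳ⁱ, (μⁱ_t)_{t ∈ I'^{,i}})` form a Cauchy sequence
within `ℭ` that is uniform over `J`, in the sense that for any `ε > 0` there is an `i̲ ≥ 1` such
that for all `i, j ≥ i̲`, `d_𝔽^{ℭ,J}((𝒳ⁱ, (μⁱ_t)), (𝒳ʲ, (μʲ_t))) ≤ ε`. Then there is a metric flow
pair `(𝒳^∞, (μ^∞_t)_{t ∈ I'^{,∞}})` over `I` that is fully defined over `J` and a family of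
isometric embeddings `(φ^∞_t : 𝒳^∞_t → Z_t)_{t ∈ I''^{,∞}}`, `I''^{,∞} ⊂ I` such that
`ℭ' := ((Z_t, d^Z_t)_{t ∈ I}, (φⁱ_t)_{t ∈ I''^{,i}, i ∈ ℕ ∪ {∞}})` (5.27) is a correspondence
between all metric flows `𝒳ⁱ`, `i ∈ ℕ ∪ {∞}`, and such that we have convergence
`d_𝔽^{ℭ',J}((𝒳ⁱ, (μⁱ_t)), (𝒳^∞, (μ^∞_t))) → 0` (5.28)."*

The printed proof has two parts: the CONSTRUCTION of the limit pair along a fast subsequence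
(`d_𝔽^{ℭ,J}(𝒳ⁱ, 𝒳^{i+1}) ≤ 2^{-i-2}`, exceptional sets `E^{i,i+1}`, `Eⁱ := ⋃_{j ≥ i} E^{j,j+1}`,
`W₁`-limits `μ^∞_t` of `(φⁱ_t)_* μⁱ_t`, Claims 5.21–5.22), and *"It remains to show (5.28), i.e.
that we have convergence within `ℭ'`"*. This file proves **Lemma 5.20 from the construction**:
`MetricFlowPair.limit_fConvergesWithin_of_limitPair` takes the construction as the hypothesis `hA`
(verbatim the statement of the tree's construction lemma `exists_limitPair_of_chain`: the limit
pair `P∞` over `I₀` with `I₀ ∖ ⋃ₖ E (i + k) ⊆ I'^{,∞}`, isometric embeddings `ι_t : 𝒳^∞_t → Z_t`,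
`H`-concentration, the `W₁`-rate
`d_{W₁}^{Z_t}((φ^{i+k}_t)_* μ^{i+k}_t, (ι_t)_* μ^∞_t) < 4 · 2^{-(i+k)}`, the approximation of
points of `𝒳^∞_t` and the convergence of the pushed conjugate heat kernels)
and concludes the statement of Lemma 5.20 in the tree's vocabulary: a limit pair `P∞`, an
`Option ℕ`-indexed correspondence `ℭ'` between all the flows, fully defined over `J`, with
`MetricFlowPair.FConvergesWithin P P∞ ℭ' J` (`MetricFlowCorrespondence.lean`). Proof: pass to a
fast subsequence `ψ` (`exists_strictMono_fDistWithinFamily_lt`) and reindex `ℭ`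
(`FamilyCorrespondence.reindex`); apply `hA`; extend `ℭ` by `P∞, ι` (`FamilyCorrespondence.extend`
= `ℭ'` of (5.27)); along the subsequence the radius `8 · 2^{-i}` is admissible for
`d_𝔽^{ℭ',J}(P (ψ i), P∞)` (`fDistAdmissibleWith_limit`, the tree's form of (5.28)–(5.31), fed with
`d_𝔽^{ℭ, I₀ ∖ Eⁱ}(P (ψ i), P (ψ (i+k))) ≤ 2 · 2^{-i}` and `|Eⁱ| ≤ 2 · 4^{-i}`,
`MetricFlowFLimitWithinAux.lean`); finally the whole Cauchy sequence converges by Prop. 5.14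
within `ℭ'` (`fDistWithinFamily_triangle`):
`d_𝔽^{ℭ',J}(P n, P∞) ≤ d_𝔽^{ℭ,J}(P n, P (ψ i)) + d_𝔽^{ℭ',J}(P (ψ i), P∞)`.

## References

* R. H. Bamler, *Compactness theory of the space of super Ricci flows*, Invent. Math. 233 (2023),
  1121–1277 (arXiv:2008.09298), §5.4, Lemma 5.20 (arXiv v1 Lemma 121), (5.27)–(5.28); §5.2,
  Prop. 5.14. [Bamler2023]
-/

noncomputable section

open Set MeasureTheory Filter TopologicalSpace Function
open scoped Topology ENNReal NNReal

namespace Literature.Geometry.Riemannian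

universe u

namespace MetricFlowPair

open MetricFlow

/-- **Bamler 2023, Lemma 5.20 (arXiv v1 Lemma 121), from the construction of the limit pair.**
Assume the construction lemma `hA`: for every fast chain of `H`-concentrated metric flow pairs in a
correspondence with complete separable comparison spaces (radii `2^{-n}` admissible for
`d_𝔽^{ℭ,J}(P n, P (n+1))` with exceptional sets `E n`) there are a limit pair `P∞` over `I₀`,
defined over `I₀ ∖ ⋂ᵢ ⋃ₖ E (i + k)`, and isometric embeddings `ι_t : 𝒳^∞_t → Z_t` with the
`W₁`-rate, the approximation property and the convergence of the conjugate heat kernels. Then for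
every sequence `P n` of `H`-concentrated metric flow pairs over `I₀` which is uniformly Cauchy over
`J` within a correspondence `ℭ` over `I₀` (complete separable comparison spaces, fully defined over
`J`), there are an `H`-concentrated metric flow pair `P∞` over `I₀`, fully defined over `J`, with
`I₀ ∖ I'^{,∞}` measurable, and a correspondence `ℭ'` between all the flows `𝒳ⁿ`, `𝒳^∞`, fully
defined over `J`, within which `P n` `𝔽`-converges to `P∞` uniformly over `J`:
`d_𝔽^{ℭ',J}(P n, P∞) → 0` (5.28).
[cite: Bamler2023, §5.4, Lemma 5.20 (arXiv v1 Lemma 121), (5.28)] -/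
theorem limit_fConvergesWithin_of_limitPair
    (hA : ∀ {I₀ : Set ℝ} {H : ℝ}, 0 ≤ H → ∀ (P : ℕ → MetricFlowPair.{u} I₀),
      (∀ n, (P n).flow.IsHConcentrated H) →
      ∀ (ℭ : FamilyCorrespondence (fun n ↦ (P n).flow) I₀),
      (∀ t, CompleteSpace (ℭ.Z t)) → (∀ t, SeparableSpace (ℭ.Z t)) →
      ∀ {J : Set ℝ} (E : ℕ → Set ℝ),
      (∀ n, FDistAdmissibleWith (P n) (P (n + 1)) (ℭ.pair n (n + 1)) (E n) J (2⁻¹ ^ n)) →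
      ∀ (hdom₁ : ∀ n, I₀ \ E n ⊆ ℭ.dom n) (_ : ∀ n, I₀ \ E n ⊆ ℭ.dom (n + 1)),
      ∃ (Pinf : MetricFlowPair.{u} I₀) (hI' : ∀ i, I₀ \ ⋃ k, E (i + k) ⊆ Pinf.I')
        (ι : ∀ (t : ℝ) (ht : t ∈ Pinf.I'), Pinf.flow.Slice ⟨t, ht⟩ → ℭ.Z ⟨t, Pinf.subset ht⟩),
        (∀ t ht, Isometry (ι t ht)) ∧ Pinf.flow.IsHConcentrated H ∧
        I₀ \ Pinf.I' = ⋂ i, ⋃ k, E (i + k) ∧ MeasurableSet (I₀ \ Pinf.I') ∧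
        (∀ i k t (ht : t ∈ I₀ \ ⋃ k, E (i + k)),
          wassersteinW1 (X := ℭ.Z ⟨t, ht.1⟩)
            (((P (i + k)).μ ⟨t, (ℭ.dom_subset (i + k)
                (hdom₁ (i + k) ⟨ht.1, fun h ↦ ht.2 (mem_iUnion.2 ⟨k, h⟩)⟩)).1⟩).map
              (ℭ.φ (i + k) t (hdom₁ (i + k) ⟨ht.1, fun h ↦ ht.2 (mem_iUnion.2 ⟨k, h⟩)⟩)))
            ((Pinf.μ ⟨t, hI' i ht⟩).map (ι t (hI' i ht))) < ENNReal.ofReal (4 * 2⁻¹ ^ (i + k))) ∧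
        (∀ i t (ht : t ∈ I₀ \ ⋃ k, E (i + k)) (z : Pinf.flow.Slice ⟨t, hI' i ht⟩),
          ∃ x : ∀ k, (P (i + k)).flow.Slice ⟨t, (ℭ.dom_subset (i + k)
              (hdom₁ (i + k) ⟨ht.1, fun h ↦ ht.2 (mem_iUnion.2 ⟨k, h⟩)⟩)).1⟩,
            Tendsto (fun k ↦ ℭ.φ (i + k) t
              (hdom₁ (i + k) ⟨ht.1, fun h ↦ ht.2 (mem_iUnion.2 ⟨k, h⟩)⟩) (x k)) atTop
              (𝓝 (ι t (hI' i ht) z))) ∧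
        (∀ i s (hs : s ∈ I₀ \ ⋃ k, E (i + k)) t (ht : t ∈ I₀ \ ⋃ k, E (i + k)), s ≤ t →
          ∀ (z : Pinf.flow.Slice ⟨t, hI' i ht⟩)
            (x : ∀ k, (P (i + k)).flow.Slice ⟨t, (ℭ.dom_subset (i + k)
              (hdom₁ (i + k) ⟨ht.1, fun h ↦ ht.2 (mem_iUnion.2 ⟨k, h⟩)⟩)).1⟩),
            Tendsto (fun k ↦ ℭ.φ (i + k) t
              (hdom₁ (i + k) ⟨ht.1, fun h ↦ ht.2 (mem_iUnion.2 ⟨k, h⟩)⟩) (x k)) atTop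
              (𝓝 (ι t (hI' i ht) z)) →
            Tendsto (fun k ↦ wassersteinW1 (X := ℭ.Z ⟨s, hs.1⟩)
              (((P (i + k)).flow.condKernel (x k) ⟨s, (ℭ.dom_subset (i + k)
                  (hdom₁ (i + k) ⟨hs.1, fun h ↦ hs.2 (mem_iUnion.2 ⟨k, h⟩)⟩)).1⟩).map
                (ℭ.φ (i + k) s (hdom₁ (i + k) ⟨hs.1, fun h ↦ hs.2 (mem_iUnion.2 ⟨k, h⟩)⟩)))
              ((Pinf.flow.condKernel z ⟨s, hI' i hs⟩).map (ι s (hI' i hs)))) atTop (𝓝 0)))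
    {I₀ : Set ℝ} {H : ℝ} (hH : 0 ≤ H)
    (P : ℕ → MetricFlowPair.{u} I₀) (hP : ∀ n, (P n).flow.IsHConcentrated H)
    (ℭ : FamilyCorrespondence (fun n ↦ (P n).flow) I₀)
    (hZc : ∀ t, CompleteSpace (ℭ.Z t)) (hZs : ∀ t, SeparableSpace (ℭ.Z t))
    {J : Set ℝ} (hJ : ℭ.FullyDefinedOver J)
    (hC : ∀ ε : ℝ≥0∞, 0 < ε → ∃ N, ∀ i ≥ N, ∀ j ≥ N, fDistWithinFamily P ℭ i j J ≤ ε) :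
    ∃ (Pinf : MetricFlowPair.{u} I₀)
      (ℭ' : FamilyCorrespondence (fun o : Option ℕ ↦ (o.elim Pinf P).flow) I₀),
      Pinf.flow.IsHConcentrated H ∧ Pinf.FullyDefinedOver J ∧ MeasurableSet (I₀ \ Pinf.I') ∧
        ℭ'.FullyDefinedOver J ∧ FConvergesWithin P Pinf ℭ' J := by
  /- Step 1 ("As we are allowed to pass to a subsequence …"): a fast subsequence `ψ`,
    `d_𝔽^{ℭ,J}(P (ψ k), P (ψ (k+1))) < 2^{-k}`, and the exceptional sets `E k` of the admissible
    radii `2^{-k}` within the reindexed correspondence. -/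
  obtain ⟨ψ, hψ, hfast⟩ := exists_strictMono_fDistWithinFamily_lt P ℭ hC
  have hex : ∀ k, ∃ E, FDistAdmissibleWith (P (ψ k)) (P (ψ (k + 1)))
      ((ℭ.reindex ψ).pair k (k + 1)) E J (2⁻¹ ^ k) := fun k ↦
    exists_fDistAdmissibleWith_of_fDistWithin_lt (by positivity) (hfast k)
  choose E hE using hex
  have hJE : ∀ i, J ⊆ I₀ \ ⋃ k, E (i + k) := fun i t ht ↦
    ⟨((hE i).subset_diff ht).1, fun h ↦ by
      obtain ⟨k, hk⟩ := mem_iUnion.1 h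
      exact ((hE (i + k)).subset_diff ht).2 hk⟩
  /- Step 2: the limit pair `P∞` and the embeddings `ι` along the subsequence (the construction). -/
  obtain ⟨Pinf, hI', ι, hι, hPinf, -, hImeas, hW1, happrox, hconv⟩ :=
    hA hH (fun k ↦ P (ψ k)) (fun k ↦ hP (ψ k)) (ℭ.reindex ψ) hZc hZs E hE
      (fun n ↦ (hE n).diff_subset_dom₁) (fun n ↦ (hE n).diff_subset_dom₂)
  /- Step 3: numerics. -/
  have hc : ∀ i : ℕ, Tendsto (fun k : ℕ ↦ (4 : ℝ) * 2⁻¹ ^ (i + k)) atTop (𝓝 0) := fun i ↦ by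
    have h := (tendsto_pow_atTop_nhds_zero_of_lt_one (r := (2⁻¹ : ℝ)) (by norm_num)
      (by norm_num)).const_mul (4 * 2⁻¹ ^ i)
    rw [mul_zero] at h
    exact h.congr fun k ↦ by rw [pow_add, mul_assoc]
  have hnum : ∀ i : ℕ,
      (2 : ℝ) * (2⁻¹ ^ i) ^ 2 ≤ (4 * 2⁻¹ ^ (i + 0) + 2 * (2 * 2⁻¹ ^ i)) ^ 2 := fun i ↦ by
    rw [Nat.add_zero]
    nlinarith [sq_nonneg ((2 : ℝ)⁻¹ ^ i)]
  have hT : Tendsto (fun i : ℕ ↦ ENNReal.ofReal (8 * 2⁻¹ ^ i)) atTop (𝓝 0) := by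
    have h := (tendsto_pow_atTop_nhds_zero_of_lt_one (r := (2⁻¹ : ℝ)) (by norm_num)
      (by norm_num)).const_mul 8
    rw [mul_zero] at h
    rw [← ENNReal.ofReal_zero]
    exact ENNReal.tendsto_ofReal h
  /- Step 4 ("It remains to show (5.28)"), along the subsequence and quantitatively: within the
    extension of the reindexed correspondence, `8 · 2^{-i}` is admissible for
    `d_𝔽^{ℭ', J}(P (ψ i), P∞)` with exceptional set `Eⁱ = ⋃ₖ E (i + k)`. -/
  have hlim : ∀ i, FDistAdmissibleWith (P (ψ i)) Pinf
      (((ℭ.reindex ψ).extend Pinf ι hι).pair (some i) none) (⋃ k, E (i + k)) J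
      (4 * 2⁻¹ ^ (i + 0) + 2 * (2 * 2⁻¹ ^ i)) := fun i ↦
    fDistAdmissibleWith_limit (P := fun k ↦ P (ψ k)) (Pinf := Pinf) (fun k ↦ hP (ψ k)) hPinf
      (ℭ' := (ℭ.reindex ψ).extend Pinf ι hι) (i := i) (E := ⋃ k, E (i + k)) (J := J)
      (MeasurableSet.iUnion fun k ↦ (hE (i + k)).measurableSet)
      (iUnion_subset fun k ↦ (hE (i + k)).subset) (hJE i)
      (fun k t ht ↦ (hE (i + k)).diff_subset_dom₁ ⟨ht.1, fun h ↦ ht.2 (mem_iUnion.2 ⟨k, h⟩)⟩)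
      (hI' i) (d := 2 * 2⁻¹ ^ i) (by positivity)
      (fun k ↦ fDistWithin_le_of_fast_chain (fun k ↦ P (ψ k)) (ℭ.reindex ψ)
        (fun n ↦ ⟨H, hP (ψ n)⟩) hE i k)
      (c := fun k ↦ 4 * 2⁻¹ ^ (i + k)) (fun k ↦ by positivity) (hc i)
      ((volume_iUnion_le_of_fast_chain (fun n ↦ (hE n).volume_le) i).trans
        (ENNReal.ofReal_le_ofReal (hnum i)))
      (fun k t ht ↦ hW1 i k t ht) (fun t ht z ↦ happrox i t ht z)
      (fun s hs t ht hst z x hx ↦ hconv i s hs t ht hst z x hx)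
  -- … read in the extension `ℭ'` of `ℭ` itself: `d_𝔽^{ℭ', J}(P (ψ i), P∞) ≤ 8 · 2^{-i}`
  have hρ : ∀ i, fDistWithin (P (ψ i)) Pinf ((ℭ.extend Pinf ι hι).pair (some (ψ i)) none) J ≤
      ENNReal.ofReal (8 * 2⁻¹ ^ i) := fun i ↦ by
    refine (fDistWithin_le (hlim i).fDistAdmissible).trans (le_of_eq ?_)
    rw [Nat.add_zero]
    congr 1
    ring
  /- Step 5: `ℭ'` and the convergence of the whole sequence within it (Prop. 5.14 within `ℭ'`). -/
  refine ⟨Pinf, ℭ.extend Pinf ι hι, hPinf, (hJE 0).trans (hI' 0), hImeas,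
    hJ.extend ((hJE 0).trans (hI' 0)) ι hι, ?_⟩
  show Tendsto (fun n ↦ fDistWithin (P n) Pinf ((ℭ.extend Pinf ι hι).pair (some n) none) J)
    atTop (𝓝 0)
  refine ENNReal.tendsto_atTop_zero.2 fun ε hε ↦ ?_
  have hε2 : 0 < ε / 2 := ENNReal.half_pos hε.ne'
  obtain ⟨N, hN⟩ := hC (ε / 2) hε2
  obtain ⟨N', hN'⟩ := ENNReal.tendsto_atTop_zero.1 hT (ε / 2) hε2
  obtain ⟨m, hmN, hmN'⟩ : ∃ m, N ≤ m ∧ N' ≤ m := ⟨max N N', le_max_left _ _, le_max_right _ _⟩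
  refine ⟨N, fun n hn ↦ ?_⟩
  calc fDistWithin (P n) Pinf ((ℭ.extend Pinf ι hι).pair (some n) none) J
      ≤ fDistWithin (P n) (P (ψ m)) (ℭ.pair n (ψ m)) J +
          fDistWithin (P (ψ m)) Pinf ((ℭ.extend Pinf ι hι).pair (some (ψ m)) none) J :=
        fDistWithinFamily_triangle (fun o : Option ℕ ↦ o.elim Pinf P) (ℭ.extend Pinf ι hι)
          (some n) (some (ψ m)) none ⟨H, hP n⟩ ⟨H, hP (ψ m)⟩ ⟨H, hPinf⟩ J
    _ ≤ ε / 2 + ε / 2 :=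
        add_le_add (hN n hn (ψ m) (hmN.trans hψ.le_apply)) ((hρ m).trans (hN' m hmN'))
    _ = ε := ENNReal.add_halves ε

end MetricFlowPair

end Literature.Geometry.Riemannian

end
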